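import Literature.NumberTheory.Rogawski1990.RankOneUnstableTransferNonsplit              -- ★ ED. 4 (p842970 F0P3-p02 (g12)): `RankOneUnstableTransferNonsplitCME`, `…CMERamified`
import Literature.NumberTheory.Rogawski1990.LocalStableClassesHTwo                      -- ★ p842188 F0P3-p02 (g11): the two `H_v`-classes of an elliptic regular stable class
import Literature.NumberTheory.Automorphic.UnitaryEllipticCentralizerCompactNonsplit    -- ★ elliptic centralisers: compact, framed by norm-one diagonals
import Literature.NumberTheory.Rogawski1990.LocalTransferSecondClassDescentCM            -- ★ A-p17: `IsCanonical.classOrbitalIntegral_eq_integral_conj_of_compactSpace_centralizer`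
import Literature.NumberTheory.Rogawski1990.FinExplicitTransferFactorStableInvariance   -- ★ B-p10: `finCharpolyTwo_eq_of_isLocalStablyConjH`
import Literature.NumberTheory.Rogawski1990.LocalTransferCompactSideJunctionCM           -- ★ B-p08: `compactSpace_cmDatum_local_one_of_smul_eq` re-export, `localStableCentralizerEquiv` cone
import Literature.NumberTheory.Rogawski1990.FinExplicitTransferFactorTorusDockSplit       -- ★ B-p08: `finCharpolyTwo_eq_of_frame`
import HarnessLib

/-!
# (G4) THE LETTER-SIDE ASSEMBLY of the rank-one unstable transfer letter: `RankOneUnstableTransferNonsplitCME` ⟸ (R1-core) at the inert places ∧ the ramified residue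
# (road «R1LL-tree»; Rogawski 1990 Lemma 4.9.3 ∕ Labesse–Langlands §2)

Topic `NumberTheory/Rogawski1990`; namespace `Literature.NumberTheory.Rogawski1990`.  THEOREMS ONLY (no definition, no instance, no notation, no named fact, no `sorry`).
Cell `pub/hodgecm-mathlib` (D-0151), crux H413 = stmt-HodgeConjecture-24833, line «N6nsGerm» stub `stub_N6nsR1LL`, road «R1LL-tree» (LEAD F0P3a-plan (g10) WORD T9-8 (A),
T9-9; architect A-p16 (g27) census 75cd9948 §2 (R1-core) = interface (I3), RULING A-1); hand (G4) = A-p19 (g22).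

WHAT THIS FILE DOES (no new mathematics: the bridge from the MEASURE-FAMILY-FREE core statement to the letter's tokens).  The letter ★ `RankOneUnstableTransferNonsplitCME`
(ED. 4: μ-guarded, `Reg` STABLY closed, torus ELLIPTIC) evaluates, at a `Reg` point `t` of the compact torus `C = Z(t₀)`, the κ-combination
`2Φ(⟦t⟧, f; m) − Σᶠ_{d ∼_st t} Φ(d, f; m)` of CANONICAL orbital integrals; the road's core statement (R1-core) speaks of the plain Bochner integrals
`O_ν(t, f) = ∫ f(y t y⁻¹) dν(y)` and `O_ν(t′, f)` at the other class `t′` of the stable pair.  The bridge: (1) every `t ∈ Z(t₀)` is `P·diag(τ₀, τ₁)·P⁻¹` with NORM-ONE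
`τᵢ` (★ `exists_normOne_diagonal_of_commute_of_mem_unitaryGroup`), regular ones have `τ₀ ≠ τ₁`; (2) hence `Z(t)` is COMPACT (★ `compactSpace_centralizer_of_eigenframe_of_smul_eq`
on the `U(Φ₂)`-factor × the compact `U(Φ₁)_v`) and so is `Z(t′)` (★ `localStableCentralizerEquiv`), so for the canonical family `Φ(⟦·⟧, f; m) = O_ν(·, f)` at both classes (★
`IsCanonical.classOrbitalIntegral_eq_integral_conj_of_compactSpace_centralizer`; `Reg` at `t′` by STABLE closure — ED. 4 (r1)); (3) the stable class of `t` has exactly the two classes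
`{⟦t⟧, ⟦t′⟧}` (★ `exists_isLocalStablyConjH_not_isConj_forall_isConj_or`), so `2Φ(⟦t⟧) − Σᶠ = O_ν(t) − O_ν(t′)`; (4) `HasCompactSupport` is free on the compact `C`.

* `rankOneUnstableTransfer_letter_at_of_core` — the pointwise engine: letter data at ONE `(L, v, ν, m, Reg, f, t₀, P, d)` + `(hcore : (R1-core) there)` ⇒ the letter's conclusion there.
* `rankOneUnstableTransferNonsplitCME_of_core_of_ramified` — THE CLOSER SHAPE: `(∀ inert data, (R1-core)) → RankOneUnstableTransferNonsplitCMERamified → RankOneUnstableTransferNonsplitCME`.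

HONEST LABEL.  HC_CM is proved only modulo the printed citations until rung 0 closes; this file is an ASSEMBLY, hypothesis-driven on (R1-core) (the road's bricks (G1)–(G3)) and on the
ramified residue (a NAMED def, not proved here).

## References
* [Rogawski1990] J. D. Rogawski, *Automorphic Representations of Unitary Groups in Three Variables*, Ann. of Math. Stud. 123 (1990): §4.9 Lemma 4.9.3, (4.9.2) p. 56; §4.3 (4.3.1) p. 43; §3.6 pp. 31–32.
* [LabesseLanglands1979] J.-P. Labesse, R. P. Langlands, *L-indistinguishability for SL(2)*, Canad. J. Math. 31 (1979): §2.
* [DeitmarEchterhoff2014] A. Deitmar, S. Echterhoff, *Principles of Harmonic Analysis*, 2nd ed. (2014): Cor. 1.5.4.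
-/

set_option autoImplicit false

noncomputable section

open Set Filter Topology MeasureTheory NumberField IsDedekindDomain Polynomial
open scoped Matrix MatrixGroups

namespace Literature.NumberTheory.Rogawski1990

open Literature.NumberTheory.Automorphic Literature.NumberTheory.Automorphic.UnitaryGroup Literature.NumberTheory.GaloisRepresentations
open Literature.AlgebraicGeometry.ShimuraVarieties (unitaryGroup mem_unitaryGroup_iff)

section Helpers

/-- In a topological group the centraliser of a conjugate is the conjugate image of the centraliser; compactness is preserved. [folklore] -/
private theorem isCompact_centralizer_of_isConj {G : Type*} [Group G] [TopologicalSpace G] [IsTopologicalGroup G] {g g' : G} (h : IsConj g g')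
    (hc : IsCompact ((Subgroup.centralizer ({g} : Set G) : Subgroup G) : Set G)) :
    IsCompact ((Subgroup.centralizer ({g'} : Set G) : Subgroup G) : Set G) := by
  obtain ⟨x, rfl⟩ := isConj_iff.1 h
  have heq : ((Subgroup.centralizer ({x * g * x⁻¹} : Set G) : Subgroup G) : Set G) =
      (fun y => x * y * x⁻¹) '' ((Subgroup.centralizer ({g} : Set G) : Subgroup G) : Set G) := by
    ext z
    simp only [SetLike.mem_coe, Subgroup.mem_centralizer_singleton_iff, Set.mem_image]
    constructor
    · intro hz
      refine ⟨x⁻¹ * z * x, ?_, by group⟩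
      calc x⁻¹ * z * x * g = x⁻¹ * (z * (x * g * x⁻¹)) * x := by group
        _ = x⁻¹ * ((x * g * x⁻¹) * z) * x := by rw [hz]
        _ = g * (x⁻¹ * z * x) := by group
    · rintro ⟨y, hy, rfl⟩
      calc x * y * x⁻¹ * (x * g * x⁻¹) = x * (y * g) * x⁻¹ := by group
        _ = x * (g * y) * x⁻¹ := by rw [hy]
        _ = x * g * x⁻¹ * (x * y * x⁻¹) := by group
  rw [heq]
  exact hc.image (by fun_prop)

/-- The centraliser of `(a, b)` in a product group is, as a set, the product of the centralisers. [folklore] -/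
private theorem coe_centralizer_prod_mk {A B : Type*} [Group A] [Group B] (a : A) (b : B) :
    ((Subgroup.centralizer ({(a, b)} : Set (A × B)) : Subgroup (A × B)) : Set (A × B)) =
      ((Subgroup.centralizer ({a} : Set A) : Subgroup A) : Set A) ×ˢ ((Subgroup.centralizer ({b} : Set B) : Subgroup B) : Set B) := by
  ext z
  simp only [SetLike.mem_coe, Subgroup.mem_centralizer_singleton_iff, Set.mem_prod, Prod.ext_iff, Prod.fst_mul, Prod.snd_mul]

/-- `(X − a)(X − b)` separable ⇒ `a ≠ b`. [folklore] -/
private theorem ne_of_separable_X_sub_C_mul {K : Type*} [Field K] {a b : K} (h : ((X - C a) * (X - C b)).Separable) : a ≠ b := by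
  rintro rfl
  exact Polynomial.not_isUnit_X_sub_C a (isCoprime_self.1 h.isCoprime)

/-- Sum over a two-element set written as `{d | p d}`. [folklore] -/
private theorem finsum_mem_eq_add_of_eq_pair' {ι : Type*} {S : Set ι} {a b : ι} (hab : a ≠ b) (hS : S = {a, b}) (F : ι → ℂ) :
    (∑ᶠ i ∈ S, F i) = F a + F b := by
  rw [hS]
  exact finsum_mem_pair hab

/-- `![a, b]` with `a ≠ b` is injective. [folklore] -/
private theorem injective_vecCons_two {K : Type*} {a b : K} (h : a ≠ b) : Function.Injective ![a, b] := by
  intro i j hij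
  fin_cases i <;> fin_cases j
  · rfl
  · exact absurd hij h
  · exact absurd hij.symm h
  · rfl

/-- At a place with ONE prime of `L` above it, that prime is fixed by complex conjugation (local copy of ★ `smul_eq_of_subsingleton_placesOver`).
[cite: CasselsFrohlichANT1967, Ch. VII Prop. 1.2 (ii)] -/
private theorem smul_eq_of_subsingleton_placesOver₈ (L : Type) [Field L] [NumberField L] [IsCMField L] {v : HeightOneSpectrum (𝓞 ↥(maximalRealSubfield L))}
    (hv : Subsingleton (PlacesOver L v)) (w : PlacesOver L v) : IsCMField.complexConj L • w.1 = w.1 := by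
  have hmem : (IsCMField.complexConj L • w.1).under (𝓞 ↥(maximalRealSubfield L)) = v := by
    rw [HeightOneSpectrum.under_algEquiv_smul]; exact w.2
  exact congrArg Subtype.val (Subsingleton.elim (⟨IsCMField.complexConj L • w.1, hmem⟩ : PlacesOver L v) w)

end Helpers

section Frame

variable (L : Type) [Field L] [NumberField L] [IsCMField L] (v : HeightOneSpectrum (𝓞 ↥(maximalRealSubfield L)))

/-- **COMPACT CENTRALISER IN `H_v` FROM AN ELLIPTIC REGULAR FRAME.**  If `t.1·P = P·diag(τ)` with `τ` injective of norm one, then `Z_{H_v}(t) = Z(t.1) × Z(t.2)` is compact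
(★ `compactSpace_centralizer_of_eigenframe_of_smul_eq` on `U(Φ₂)_v`, and `U(Φ₁)_v` is compact at a non-split place). [cite: Rogawski1990, §3.6 pp. 31–32] -/
theorem compactSpace_centralizer_H_of_frame (w : PlacesOver L v) (hw : IsCMField.complexConj L • w.1 = w.1)
    (t : ((cmDatum L 2 (Matrix.of fun i j : Fin 2 => if i.val + j.val + 1 = 2 then (1 : L) else 0)).Local v × (cmDatum L 1 (Matrix.of fun i j : Fin 1 => if i.val + j.val + 1 = 1 then (1 : L) else 0)).Local v)) (P : GL (Fin 2) (LocalRing L v)) (τ : Fin 2 → (LocalRing L v))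
    (hP : (t.1.val.val : Matrix (Fin 2) (Fin 2) (LocalRing L v)) * P.val = P.val * Matrix.diagonal τ) (hτ : Function.Injective τ)
    (hτ1 : ∀ i, conjLocal L (IsCMField.complexConj L) v (τ i) * τ i = 1) :
    CompactSpace ↥(Subgroup.centralizer ({t} : Set ((cmDatum L 2 (Matrix.of fun i j : Fin 2 => if i.val + j.val + 1 = 2 then (1 : L) else 0)).Local v × (cmDatum L 1 (Matrix.of fun i j : Fin 1 => if i.val + j.val + 1 = 1 then (1 : L) else 0)).Local v))) := by
  have hΦh : (((Matrix.of fun i j : Fin 2 => if i.val + j.val + 1 = 2 then (1 : L) else 0)).map (cmConjRingHom L))ᵀ = (Matrix.of fun i j : Fin 2 => if i.val + j.val + 1 = 2 then (1 : L) else 0) := by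
    ext i j; fin_cases i <;> fin_cases j <;> simp [Matrix.of_apply]
  have hΦd : ((Matrix.of fun i j : Fin 2 => if i.val + j.val + 1 = 2 then (1 : L) else 0)).det ≠ 0 := (isUnit_antidiagOne_det (L := L) (N := 2)).ne_zero
  haveI hZ1 : CompactSpace ↥(Subgroup.centralizer ({t.1} : Set ((cmDatum L 2 (Matrix.of fun i j : Fin 2 => if i.val + j.val + 1 = 2 then (1 : L) else 0)).Local v))) := compactSpace_centralizer_of_eigenframe_of_smul_eq L w hw _ hΦh hΦd t.1 hP hτ hτ1
  haveI : CompactSpace ((cmDatum L 1 (Matrix.of fun i j : Fin 1 => if i.val + j.val + 1 = 1 then (1 : L) else 0)).Local v) := compactSpace_cmDatum_local_one_of_smul_eq L _ w hw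
  have hZ1' : IsCompact ((Subgroup.centralizer ({t.1} : Set ((cmDatum L 2 (Matrix.of fun i j : Fin 2 => if i.val + j.val + 1 = 2 then (1 : L) else 0)).Local v)) : Subgroup ((cmDatum L 2 (Matrix.of fun i j : Fin 2 => if i.val + j.val + 1 = 2 then (1 : L) else 0)).Local v)) : Set ((cmDatum L 2 (Matrix.of fun i j : Fin 2 => if i.val + j.val + 1 = 2 then (1 : L) else 0)).Local v)) := isCompact_iff_compactSpace.2 hZ1
  have hZ2 : IsCompact ((Subgroup.centralizer ({t.2} : Set ((cmDatum L 1 (Matrix.of fun i j : Fin 1 => if i.val + j.val + 1 = 1 then (1 : L) else 0)).Local v)) : Subgroup ((cmDatum L 1 (Matrix.of fun i j : Fin 1 => if i.val + j.val + 1 = 1 then (1 : L) else 0)).Local v)) : Set ((cmDatum L 1 (Matrix.of fun i j : Fin 1 => if i.val + j.val + 1 = 1 then (1 : L) else 0)).Local v)) := (isClosed_coe_centralizer_singleton t.2).isCompact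
  refine isCompact_iff_compactSpace.1 ?_
  obtain ⟨t1, t2⟩ := t
  rw [coe_centralizer_prod_mk]
  exact hZ1'.prod hZ2

/-- **EVERY ELEMENT OF AN ELLIPTIC REGULAR TORUS OF `H_v` IS FRAMED BY NORM-ONE EIGENVALUES.**  For `t₀ ∈ H_v` with `t₀.1` regular and an eigenframe `t₀.1·P = P·diag d`,
`σ(dᵢ) dᵢ = 1`, every `t ∈ Z(t₀)` satisfies `t.1·P = P·diag(τ₀, τ₁)` with `τᵢ = (P⁻¹ t.1 P)ᵢᵢ` of norm one (★ `exists_normOne_diagonal_of_commute_of_mem_unitaryGroup`).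
[cite: Rogawski1990, §3.5 p. 29; §3.6 pp. 31–32] -/
theorem normOne_frame_of_mem_centralizer (w : PlacesOver L v) (hw : IsCMField.complexConj L • w.1 = w.1)
    (t₀ : ((cmDatum L 2 (Matrix.of fun i j : Fin 2 => if i.val + j.val + 1 = 2 then (1 : L) else 0)).Local v × (cmDatum L 1 (Matrix.of fun i j : Fin 1 => if i.val + j.val + 1 = 1 then (1 : L) else 0)).Local v)) (P : GL (Fin 2) (LocalRing L v)) (d : Fin 2 → (LocalRing L v)) (ht₀ : IsRegularElt (t₀.1.val : GL (Fin 2) (LocalRing L v)))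
    (hP : (t₀.1.val.val : Matrix (Fin 2) (Fin 2) (LocalRing L v)) * P.val = P.val * Matrix.diagonal d) (hd1 : ∀ i, conjLocal L (IsCMField.complexConj L) v (d i) * d i = 1)
    (t : ((cmDatum L 2 (Matrix.of fun i j : Fin 2 => if i.val + j.val + 1 = 2 then (1 : L) else 0)).Local v × (cmDatum L 1 (Matrix.of fun i j : Fin 1 => if i.val + j.val + 1 = 1 then (1 : L) else 0)).Local v)) (ht : t ∈ Subgroup.centralizer ({t₀} : Set ((cmDatum L 2 (Matrix.of fun i j : Fin 2 => if i.val + j.val + 1 = 2 then (1 : L) else 0)).Local v × (cmDatum L 1 (Matrix.of fun i j : Fin 1 => if i.val + j.val + 1 = 1 then (1 : L) else 0)).Local v))) :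
    (∀ i, conjLocal L (IsCMField.complexConj L) v (![((P⁻¹).val * (t.1.val.val : Matrix (Fin 2) (Fin 2) (LocalRing L v)) * P.val) 0 0, ((P⁻¹).val * (t.1.val.val : Matrix (Fin 2) (Fin 2) (LocalRing L v)) * P.val) 1 1] i) *
        ![((P⁻¹).val * (t.1.val.val : Matrix (Fin 2) (Fin 2) (LocalRing L v)) * P.val) 0 0, ((P⁻¹).val * (t.1.val.val : Matrix (Fin 2) (Fin 2) (LocalRing L v)) * P.val) 1 1] i = 1) ∧
      (t.1.val.val : Matrix (Fin 2) (Fin 2) (LocalRing L v)) * P.val = P.val * Matrix.diagonal ![((P⁻¹).val * (t.1.val.val : Matrix (Fin 2) (Fin 2) (LocalRing L v)) * P.val) 0 0, ((P⁻¹).val * (t.1.val.val : Matrix (Fin 2) (Fin 2) (LocalRing L v)) * P.val) 1 1] := by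
  classical
  have hc1 : IsCMField.complexConj L ≠ 1 := IsCMField.complexConj_ne_one L
  letI : Field (LocalRing L v) := (LocalRing.isField_of_smul_eq (IsCMField.complexConj L) hc1 w hw).toField
  have hΦd : ((Matrix.of fun i j : Fin 2 => if i.val + j.val + 1 = 2 then (1 : L) else 0)).det ≠ 0 := (isUnit_antidiagOne_det (L := L) (N := 2)).ne_zero
  have hHd : ((adelicForm L 2 (Matrix.of fun i j : Fin 2 => if i.val + j.val + 1 = 2 then (1 : L) else 0)).map (adeleToLocal L v)).det ≠ 0 := (isUnit_det_localForm L 2 _ v hΦd).ne_zero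
  have hU : ∀ g : ((cmDatum L 2 (Matrix.of fun i j : Fin 2 => if i.val + j.val + 1 = 2 then (1 : L) else 0)).Local v), g.val ∈ unitaryGroup (conjLocal L (IsCMField.complexConj L) v) ((adelicForm L 2 (Matrix.of fun i j : Fin 2 => if i.val + j.val + 1 = 2 then (1 : L) else 0)).map (adeleToLocal L v)) :=
    fun g => (mem_unitaryGroup_iff (σ := conjLocal L (IsCMField.complexConj L) v) (H := ((adelicForm L 2 (Matrix.of fun i j : Fin 2 => if i.val + j.val + 1 = 2 then (1 : L) else 0)).map (adeleToLocal L v))) (g := g.val)).2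
      ((mem_unitaryGroupOfForm_iff (σ := conjLocal L (IsCMField.complexConj L) v) (J := ((adelicForm L 2 (Matrix.of fun i j : Fin 2 => if i.val + j.val + 1 = 2 then (1 : L) else 0)).map (adeleToLocal L v))) (g := g.val)).1 g.2)
  -- `d` is injective: `χ_{t₀.1} = (X − d₀)(X − d₁)` is separable
  have hd01 : d 0 ≠ d 1 := by
    have hdvec : d = ![d 0, d 1] := by funext i; fin_cases i <;> rfl
    have hχ : finCharpolyTwo L v t₀ = (X - C (d 0)) * (X - C (d 1)) := finCharpolyTwo_eq_of_frame P (by rw [← hdvec]; exact hP)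
    have hsep : (finCharpolyTwo L v t₀).Separable := ht₀
    rw [hχ] at hsep
    exact ne_of_separable_X_sub_C_mul hsep
  have hdinj : Function.Injective d := by
    have hdvec : d = ![d 0, d 1] := by funext i; fin_cases i <;> rfl
    rw [hdvec]; exact injective_vecCons_two hd01
  -- the frame of `t.1`
  have hcomm : Commute (t.1.val.val : Matrix (Fin 2) (Fin 2) (LocalRing L v)) (t₀.1.val.val : Matrix (Fin 2) (Fin 2) (LocalRing L v)) := by
    have h := Subgroup.mem_centralizer_singleton_iff.1 ht
    have h1 : t.1 * t₀.1 = t₀.1 * t.1 := congrArg Prod.fst h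
    exact congrArg (fun g : ((cmDatum L 2 (Matrix.of fun i j : Fin 2 => if i.val + j.val + 1 = 2 then (1 : L) else 0)).Local v) => (g.val.val : Matrix (Fin 2) (Fin 2) (LocalRing L v))) h1
  obtain ⟨τ, hτ1, hτ⟩ := exists_normOne_diagonal_of_commute_of_mem_unitaryGroup (conjLocal L (IsCMField.complexConj L) v) _ hHd (hU t₀.1) hP hdinj hd1
    (z := t.1.val) (hU t.1) hcomm
  have hPP : (P⁻¹).val * P.val = 1 := by rw [← Units.val_mul, inv_mul_cancel, Units.val_one]
  have hdiag : (P⁻¹).val * (t.1.val.val : Matrix (Fin 2) (Fin 2) (LocalRing L v)) * P.val = Matrix.diagonal τ := by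
    rw [hτ]
    calc (P⁻¹).val * (P.val * Matrix.diagonal τ * (P⁻¹).val) * P.val
        = ((P⁻¹).val * P.val) * Matrix.diagonal τ * ((P⁻¹).val * P.val) := by simp only [Matrix.mul_assoc]
      _ = Matrix.diagonal τ := by rw [hPP, Matrix.one_mul, Matrix.mul_one]
  have hτi : ∀ i, ((P⁻¹).val * (t.1.val.val : Matrix (Fin 2) (Fin 2) (LocalRing L v)) * P.val) i i = τ i := fun i => by rw [hdiag, Matrix.diagonal_apply_eq]
  have hframe : (t.1.val.val : Matrix (Fin 2) (Fin 2) (LocalRing L v)) * P.val = P.val * Matrix.diagonal τ := by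
    rw [hτ, Matrix.mul_assoc (P.val * Matrix.diagonal τ), hPP, Matrix.mul_one]
  have hτvec : ![((P⁻¹).val * (t.1.val.val : Matrix (Fin 2) (Fin 2) (LocalRing L v)) * P.val) 0 0, ((P⁻¹).val * (t.1.val.val : Matrix (Fin 2) (Fin 2) (LocalRing L v)) * P.val) 1 1] = τ := by
    funext i; fin_cases i
    · simpa using hτi 0
    · simpa using hτi 1
  exact ⟨by rw [hτvec]; exact hτ1, by rw [hτvec]; exact hframe⟩

end Frame

section Engine

variable (L : Type) [Field L] [NumberField L] [IsCMField L] (v : HeightOneSpectrum (𝓞 ↥(maximalRealSubfield L)))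

/-- **Canonical ⇒ Bochner at a class with compact centraliser, representative form** (★ `IsCanonical.classOrbitalIntegral_eq_integral_conj_of_compactSpace_centralizer` with the class
read at `g` itself: `P` conjugation-closed at `g`, `Z(g)` compact). [cite: DeitmarEchterhoff2014, Cor. 1.5.4] [cite: Rogawski1990, §4.3 (4.3.1) p. 43] -/
theorem classOrbitalIntegral_mk_eq_integral_conj_of_isCompact_centralizer
    [MeasurableSpace ((cmDatum L 2 (Matrix.of fun i j : Fin 2 => if i.val + j.val + 1 = 2 then (1 : L) else 0)).Local v × (cmDatum L 1 (Matrix.of fun i j : Fin 1 => if i.val + j.val + 1 = 1 then (1 : L) else 0)).Local v)] [BorelSpace ((cmDatum L 2 (Matrix.of fun i j : Fin 2 => if i.val + j.val + 1 = 2 then (1 : L) else 0)).Local v × (cmDatum L 1 (Matrix.of fun i j : Fin 1 => if i.val + j.val + 1 = 1 then (1 : L) else 0)).Local v)] (ν : Measure ((cmDatum L 2 (Matrix.of fun i j : Fin 2 => if i.val + j.val + 1 = 2 then (1 : L) else 0)).Local v × (cmDatum L 1 (Matrix.of fun i j : Fin 1 => if i.val + j.val + 1 = 1 then (1 : L) else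 0)).Local v)) [ν.IsHaarMeasure] [ν.IsMulRightInvariant]
    [iZ : ∀ γ : ((cmDatum L 2 (Matrix.of fun i j : Fin 2 => if i.val + j.val + 1 = 2 then (1 : L) else 0)).Local v × (cmDatum L 1 (Matrix.of fun i j : Fin 1 => if i.val + j.val + 1 = 1 then (1 : L) else 0)).Local v), MeasurableSpace (((cmDatum L 2 (Matrix.of fun i j : Fin 2 => if i.val + j.val + 1 = 2 then (1 : L) else 0)).Local v × (cmDatum L 1 (Matrix.of fun i j : Fin 1 => if i.val + j.val + 1 = 1 then (1 : L) else 0)).Local v) ⧸ Subgroup.centralizer ({γ} : Set ((cmDatum L 2 (Matrix.of fun i j : Fin 2 => if i.val + j.val + 1 = 2 then (1 : L) else 0)).Local v × (cmDatum L 1 (Matrix.of fun i j : Fin 1 => if i.val + j.val + 1 = 1 then (1 : L) else 0)).Local v)))]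
    [bZ : ∀ γ : ((cmDatum L 2 (Matrix.of fun i j : Fin 2 => if i.val + j.val + 1 = 2 then (1 : L) else 0)).Local v × (cmDatum L 1 (Matrix.of fun i j : Fin 1 => if i.val + j.val + 1 = 1 then (1 : L) else 0)).Local v), BorelSpace (((cmDatum L 2 (Matrix.of fun i j : Fin 2 => if i.val + j.val + 1 = 2 then (1 : L) else 0)).Local v × (cmDatum L 1 (Matrix.of fun i j : Fin 1 => if i.val + j.val + 1 = 1 then (1 : L) else 0)).Local v) ⧸ Subgroup.centralizer ({γ} : Set ((cmDatum L 2 (Matrix.of fun i j : Fin 2 => if i.val + j.val + 1 = 2 then (1 : L) else 0)).Local v × (cmDatum L 1 (Matrix.of fun i j : Fin 1 => if i.val + j.val + 1 = 1 then (1 : L) else 0)).Local v)))]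
    {m : OrbitalMeasureFamily ((cmDatum L 2 (Matrix.of fun i j : Fin 2 => if i.val + j.val + 1 = 2 then (1 : L) else 0)).Local v × (cmDatum L 1 (Matrix.of fun i j : Fin 1 => if i.val + j.val + 1 = 1 then (1 : L) else 0)).Local v)} {Reg : ((cmDatum L 2 (Matrix.of fun i j : Fin 2 => if i.val + j.val + 1 = 2 then (1 : L) else 0)).Local v × (cmDatum L 1 (Matrix.of fun i j : Fin 1 => if i.val + j.val + 1 = 1 then (1 : L) else 0)).Local v) → Prop} (hconj : ∀ γ x, Reg γ → Reg (x * γ * x⁻¹)) (hm : m.IsCanonical Reg ν)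
    (f : ((cmDatum L 2 (Matrix.of fun i j : Fin 2 => if i.val + j.val + 1 = 2 then (1 : L) else 0)).Local v × (cmDatum L 1 (Matrix.of fun i j : Fin 1 => if i.val + j.val + 1 = 1 then (1 : L) else 0)).Local v) → ℂ) (hf : Continuous f) (g : ((cmDatum L 2 (Matrix.of fun i j : Fin 2 => if i.val + j.val + 1 = 2 then (1 : L) else 0)).Local v × (cmDatum L 1 (Matrix.of fun i j : Fin 1 => if i.val + j.val + 1 = 1 then (1 : L) else 0)).Local v)) (hg : Reg g) (hZ : CompactSpace ↥(Subgroup.centralizer ({g} : Set ((cmDatum L 2 (Matrix.of fun i j : Fin 2 => if i.val + j.val + 1 = 2 then (1 : L) else 0)).Local v × (cmDatum L 1 (Matrix.of fun i j : Fin 1 => if i.val + j.val + 1 = 1 then (1 : L) else 0)).Local v)))) :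
    classOrbitalIntegral m f (ConjClasses.mk g) = ∫ y, f (y * g * y⁻¹) ∂ν := by
  have hout : ConjClasses.mk (Quotient.out (ConjClasses.mk g)) = ConjClasses.mk g := by rw [← ConjClasses.quotient_mk_eq_mk, Quotient.out_eq]
  have hrep : IsConj g (Quotient.out (ConjClasses.mk g)) := ConjClasses.mk_eq_mk_iff_isConj.1 hout.symm
  obtain ⟨x, hx⟩ := isConj_iff.1 hrep
  haveI : CompactSpace ↥(Subgroup.centralizer ({(Quotient.out (ConjClasses.mk g) : ((cmDatum L 2 (Matrix.of fun i j : Fin 2 => if i.val + j.val + 1 = 2 then (1 : L) else 0)).Local v × (cmDatum L 1 (Matrix.of fun i j : Fin 1 => if i.val + j.val + 1 = 1 then (1 : L) else 0)).Local v))} : Set ((cmDatum L 2 (Matrix.of fun i j : Fin 2 => if i.val + j.val + 1 = 2 then (1 : L) else 0)).Local v × (cmDatum L 1 (Matrix.of fun i j : Fin 1 => if i.val + j.val + 1 = 1 then (1 : L) else 0)).Local v))) :=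
    isCompact_iff_compactSpace.1 (isCompact_centralizer_of_isConj hrep (isCompact_iff_compactSpace.2 hZ))
  exact IsCanonical.classOrbitalIntegral_eq_integral_conj_of_compactSpace_centralizer hm (by rw [← hx]; exact hconj _ x hg) f hf g rfl

/-- **(G4) THE POINTWISE ENGINE — the letter's conclusion at ONE `(L, v, ν, m, Reg, f, t₀, P, d)` from (R1-core) there.**  Hypotheses = the binders of ★
`RankOneUnstableTransferNonsplitCME` at one place (`Reg` ⊆ `U(Φ₂)`-regular, conjugation- and STABLY closed; `m` canonical for `(Reg, ν)`; `f ∈ C_c^∞`; `t₀.1` regular with an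
elliptic eigenframe) + `hcore` = the architect's (R1-core) (census 75cd9948 §2) for these data: a locally constant `fC` on `Z(t₀)` with
`Δ(t)·(∫ f(y t y⁻¹) dν − ∫ f(y t′ y⁻¹) dν) = fC t` for every regular `t ∈ Z(t₀)` and every `t′` stably conjugate, not conjugate, to `t`.  Conclusion = the letter's at these data
(`μW` is the character inside `Δ`; the μ-guards are consumed by (R1-core)'s provider, not here). [cite: Rogawski1990, §4.9 Lemma 4.9.3 (4.9.2) p. 56; §4.3 (4.3.1) p. 43] [cite: LabesseLanglands1979, §2] -/
theorem rankOneUnstableTransfer_letter_at_of_core (hv : Subsingleton (PlacesOver L v)) (μW : HeckeCharacter L)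
    [MeasurableSpace ((cmDatum L 2 (Matrix.of fun i j : Fin 2 => if i.val + j.val + 1 = 2 then (1 : L) else 0)).Local v × (cmDatum L 1 (Matrix.of fun i j : Fin 1 => if i.val + j.val + 1 = 1 then (1 : L) else 0)).Local v)] [BorelSpace ((cmDatum L 2 (Matrix.of fun i j : Fin 2 => if i.val + j.val + 1 = 2 then (1 : L) else 0)).Local v × (cmDatum L 1 (Matrix.of fun i j : Fin 1 => if i.val + j.val + 1 = 1 then (1 : L) else 0)).Local v)] (ν : Measure ((cmDatum L 2 (Matrix.of fun i j : Fin 2 => if i.val + j.val + 1 = 2 then (1 : L) else 0)).Local v × (cmDatum L 1 (Matrix.of fun i j : Fin 1 => if i.val + j.val + 1 = 1 then (1 : L) else 0)).Local v)) [ν.IsHaarMeasure] [ν.IsMulRightInvariant]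
    [iZ : ∀ γ : ((cmDatum L 2 (Matrix.of fun i j : Fin 2 => if i.val + j.val + 1 = 2 then (1 : L) else 0)).Local v × (cmDatum L 1 (Matrix.of fun i j : Fin 1 => if i.val + j.val + 1 = 1 then (1 : L) else 0)).Local v), MeasurableSpace (((cmDatum L 2 (Matrix.of fun i j : Fin 2 => if i.val + j.val + 1 = 2 then (1 : L) else 0)).Local v × (cmDatum L 1 (Matrix.of fun i j : Fin 1 => if i.val + j.val + 1 = 1 then (1 : L) else 0)).Local v) ⧸ Subgroup.centralizer ({γ} : Set ((cmDatum L 2 (Matrix.of fun i j : Fin 2 => if i.val + j.val + 1 = 2 then (1 : L) else 0)).Local v × (cmDatum L 1 (Matrix.of fun i j : Fin 1 => if i.val + j.val + 1 = 1 then (1 : L) else 0)).Local v)))]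
    [bZ : ∀ γ : ((cmDatum L 2 (Matrix.of fun i j : Fin 2 => if i.val + j.val + 1 = 2 then (1 : L) else 0)).Local v × (cmDatum L 1 (Matrix.of fun i j : Fin 1 => if i.val + j.val + 1 = 1 then (1 : L) else 0)).Local v), BorelSpace (((cmDatum L 2 (Matrix.of fun i j : Fin 2 => if i.val + j.val + 1 = 2 then (1 : L) else 0)).Local v × (cmDatum L 1 (Matrix.of fun i j : Fin 1 => if i.val + j.val + 1 = 1 then (1 : L) else 0)).Local v) ⧸ Subgroup.centralizer ({γ} : Set ((cmDatum L 2 (Matrix.of fun i j : Fin 2 => if i.val + j.val + 1 = 2 then (1 : L) else 0)).Local v × (cmDatum L 1 (Matrix.of fun i j : Fin 1 => if i.val + j.val + 1 = 1 then (1 : L) else 0)).Local v)))]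
    (m : OrbitalMeasureFamily ((cmDatum L 2 (Matrix.of fun i j : Fin 2 => if i.val + j.val + 1 = 2 then (1 : L) else 0)).Local v × (cmDatum L 1 (Matrix.of fun i j : Fin 1 => if i.val + j.val + 1 = 1 then (1 : L) else 0)).Local v))
    (Reg : ((cmDatum L 2 (Matrix.of fun i j : Fin 2 => if i.val + j.val + 1 = 2 then (1 : L) else 0)).Local v × (cmDatum L 1 (Matrix.of fun i j : Fin 1 => if i.val + j.val + 1 = 1 then (1 : L) else 0)).Local v) → Prop) (hReg : ∀ γ, Reg γ → IsRegularElt (γ.1.val : GL (Fin 2) (LocalRing L v))) (hconj : ∀ γ x, Reg γ → Reg (x * γ * x⁻¹))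
    (hstab : ∀ γ δ, Reg γ → IsLocalStablyConjH L v γ δ → Reg δ) (hm : m.IsCanonical Reg ν)
    (f : ((cmDatum L 2 (Matrix.of fun i j : Fin 2 => if i.val + j.val + 1 = 2 then (1 : L) else 0)).Local v × (cmDatum L 1 (Matrix.of fun i j : Fin 1 => if i.val + j.val + 1 = 1 then (1 : L) else 0)).Local v) → ℂ) (hf : IsLocSmooth f)
    (t₀ : ((cmDatum L 2 (Matrix.of fun i j : Fin 2 => if i.val + j.val + 1 = 2 then (1 : L) else 0)).Local v × (cmDatum L 1 (Matrix.of fun i j : Fin 1 => if i.val + j.val + 1 = 1 then (1 : L) else 0)).Local v)) (P : GL (Fin 2) (LocalRing L v)) (d : Fin 2 → (LocalRing L v)) (ht₀ : IsRegularElt (t₀.1.val : GL (Fin 2) (LocalRing L v)))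
    (hP : (t₀.1.val.val : Matrix (Fin 2) (Fin 2) (LocalRing L v)) * P.val = P.val * Matrix.diagonal d) (hd1 : ∀ i, conjLocal L (IsCMField.complexConj L) v (d i) * d i = 1)
    (hcore : ∃ fC : ↥(Subgroup.centralizer ({t₀} : Set ((cmDatum L 2 (Matrix.of fun i j : Fin 2 => if i.val + j.val + 1 = 2 then (1 : L) else 0)).Local v × (cmDatum L 1 (Matrix.of fun i j : Fin 1 => if i.val + j.val + 1 = 1 then (1 : L) else 0)).Local v))) → ℂ, IsLocallyConstant fC ∧
      ∀ t : ↥(Subgroup.centralizer ({t₀} : Set ((cmDatum L 2 (Matrix.of fun i j : Fin 2 => if i.val + j.val + 1 = 2 then (1 : L) else 0)).Local v × (cmDatum L 1 (Matrix.of fun i j : Fin 1 => if i.val + j.val + 1 = 1 then (1 : L) else 0)).Local v))), IsRegularElt ((t : ((cmDatum L 2 (Matrix.of fun i j : Fin 2 => if i.val + j.val + 1 = 2 then (1 : L) else 0)).Local v × (cmDatum L 1 (Matrix.of fun i j : Fin 1 => if i.val + j.val + 1 = 1 then (1 : L) else 0)).Local v)).1.val : GL (Fin 2) (LocalRing L v))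 → ∀ t' : ((cmDatum L 2 (Matrix.of fun i j : Fin 2 => if i.val + j.val + 1 = 2 then (1 : L) else 0)).Local v × (cmDatum L 1 (Matrix.of fun i j : Fin 1 => if i.val + j.val + 1 = 1 then (1 : L) else 0)).Local v),
        IsLocalStablyConjH L v (t : ((cmDatum L 2 (Matrix.of fun i j : Fin 2 => if i.val + j.val + 1 = 2 then (1 : L) else 0)).Local v × (cmDatum L 1 (Matrix.of fun i j : Fin 1 => if i.val + j.val + 1 = 1 then (1 : L) else 0)).Local v)) t' → ¬ IsConj (t : ((cmDatum L 2 (Matrix.of fun i j : Fin 2 => if i.val + j.val + 1 = 2 then (1 : L) else 0)).Local v × (cmDatum L 1 (Matrix.of fun i j : Fin 1 => if i.val + j.val + 1 = 1 then (1 : L) else 0)).Local v)) t' →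
        ((finHeckeValue L v μW (((P⁻¹).val * ((t : ((cmDatum L 2 (Matrix.of fun i j : Fin 2 => if i.val + j.val + 1 = 2 then (1 : L) else 0)).Local v × (cmDatum L 1 (Matrix.of fun i j : Fin 1 => if i.val + j.val + 1 = 1 then (1 : L) else 0)).Local v)).1.val.val : Matrix (Fin 2) (Fin 2) (LocalRing L v)) * P.val) 0 0 - ((P⁻¹).val * ((t : ((cmDatum L 2 (Matrix.of fun i j : Fin 2 => if i.val + j.val + 1 = 2 then (1 : L) else 0)).Local v × (cmDatum L 1 (Matrix.of fun i j : Fin 1 => if i.val + j.val + 1 = 1 then (1 : L) else 0)).Local v)).1.val.val : Matrix (Fin 2) (Fin 2) (LocalRing L v)) * P.val) 1 1))⁻¹ : ℂ) *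
          ((Real.sqrt (∏ w' : PlacesOver L v, ‖(((P⁻¹).val * ((t : ((cmDatum L 2 (Matrix.of fun i j : Fin 2 => if i.val + j.val + 1 = 2 then (1 : L) else 0)).Local v × (cmDatum L 1 (Matrix.of fun i j : Fin 1 => if i.val + j.val + 1 = 1 then (1 : L) else 0)).Local v)).1.val.val : Matrix (Fin 2) (Fin 2) (LocalRing L v)) * P.val) 0 0 - ((P⁻¹).val * ((t : ((cmDatum L 2 (Matrix.of fun i j : Fin 2 => if i.val + j.val + 1 = 2 then (1 : L) else 0)).Local v × (cmDatum L 1 (Matrix.of fun i j : Fin 1 => if i.val + j.val + 1 = 1 then (1 : L) else 0)).Local v)).1.val.val : Matrix (Fin 2) (Fin 2) (LocalRing L v)) * P.val) 1 1) w'‖) : ℝ) : ℂ) * ((∫ y, f (y * (t : ((cmDatum L 2 (Matrix.of fun i j : Fin 2 => if i.val + j.val + 1 = 2 then (1 : L) else 0)).Local v × (cmDatum L 1 (Matrix.of fun i j : Fin 1 => if i.val + j.val + 1 = 1 then (1 : L) else 0)).Local v)) * y⁻¹) ∂ν) - ∫ y, f (y * t' * y⁻¹) ∂ν) = fC t) 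:
    ∃ fC : ↥(Subgroup.centralizer ({t₀} : Set ((cmDatum L 2 (Matrix.of fun i j : Fin 2 => if i.val + j.val + 1 = 2 then (1 : L) else 0)).Local v × (cmDatum L 1 (Matrix.of fun i j : Fin 1 => if i.val + j.val + 1 = 1 then (1 : L) else 0)).Local v))) → ℂ, IsLocallyConstant fC ∧ HasCompactSupport fC ∧
      ∀ t : ↥(Subgroup.centralizer ({t₀} : Set ((cmDatum L 2 (Matrix.of fun i j : Fin 2 => if i.val + j.val + 1 = 2 then (1 : L) else 0)).Local v × (cmDatum L 1 (Matrix.of fun i j : Fin 1 => if i.val + j.val + 1 = 1 then (1 : L) else 0)).Local v))), Reg (t : ((cmDatum L 2 (Matrix.of fun i j : Fin 2 => if i.val + j.val + 1 = 2 then (1 : L) else 0)).Local v × (cmDatum L 1 (Matrix.of fun i j : Fin 1 => if i.val + j.val + 1 = 1 then (1 : L) else 0)).Local v)) →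
        ((finHeckeValue L v μW (((P⁻¹).val * ((t : ((cmDatum L 2 (Matrix.of fun i j : Fin 2 => if i.val + j.val + 1 = 2 then (1 : L) else 0)).Local v × (cmDatum L 1 (Matrix.of fun i j : Fin 1 => if i.val + j.val + 1 = 1 then (1 : L) else 0)).Local v)).1.val.val : Matrix (Fin 2) (Fin 2) (LocalRing L v)) * P.val) 0 0 - ((P⁻¹).val * ((t : ((cmDatum L 2 (Matrix.of fun i j : Fin 2 => if i.val + j.val + 1 = 2 then (1 : L) else 0)).Local v × (cmDatum L 1 (Matrix.of fun i j : Fin 1 => if i.val + j.val + 1 = 1 then (1 : L) else 0)).Local v)).1.val.val : Matrix (Fin 2) (Fin 2) (LocalRing L v)) * P.val) 1 1))⁻¹ : ℂ) *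
          ((Real.sqrt (∏ w' : PlacesOver L v, ‖(((P⁻¹).val * ((t : ((cmDatum L 2 (Matrix.of fun i j : Fin 2 => if i.val + j.val + 1 = 2 then (1 : L) else 0)).Local v × (cmDatum L 1 (Matrix.of fun i j : Fin 1 => if i.val + j.val + 1 = 1 then (1 : L) else 0)).Local v)).1.val.val : Matrix (Fin 2) (Fin 2) (LocalRing L v)) * P.val) 0 0 - ((P⁻¹).val * ((t : ((cmDatum L 2 (Matrix.of fun i j : Fin 2 => if i.val + j.val + 1 = 2 then (1 : L) else 0)).Local v × (cmDatum L 1 (Matrix.of fun i j : Fin 1 => if i.val + j.val + 1 = 1 then (1 : L) else 0)).Local v)).1.val.val : Matrix (Fin 2) (Fin 2) (LocalRing L v)) * P.val) 1 1) w'‖) : ℝ) : ℂ) * (2 * classOrbitalIntegral m f (ConjClasses.mk (t : ((cmDatum L 2 (Matrix.of fun i j : Fin 2 => if i.val + j.val + 1 = 2 then (1 : L) else 0)).Local v × (cmDatum L 1 (Matrix.of fun i j : Fin 1 => if i.val + j.val + 1 = 1 then (1 : L) else 0)).Local v))) -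
            ∑ᶠ d ∈ {d : ConjClasses ((cmDatum L 2 (Matrix.of fun i j : Fin 2 => if i.val + j.val + 1 = 2 then (1 : L) else 0)).Local v × (cmDatum L 1 (Matrix.of fun i j : Fin 1 => if i.val + j.val + 1 = 1 then (1 : L) else 0)).Local v) | IsLocalStablyConjH L v (t : ((cmDatum L 2 (Matrix.of fun i j : Fin 2 => if i.val + j.val + 1 = 2 then (1 : L) else 0)).Local v × (cmDatum L 1 (Matrix.of fun i j : Fin 1 => if i.val + j.val + 1 = 1 then (1 : L) else 0)).Local v)) (Quotient.out d)}, classOrbitalIntegral m f d) = fC t := by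
  classical
  obtain ⟨w⟩ := PlacesOver.nonempty L v
  have hw : IsCMField.complexConj L • w.1 = w.1 := smul_eq_of_subsingleton_placesOver₈ L hv w
  letI : Field (LocalRing L v) := (LocalRing.isField_of_smul_eq (IsCMField.complexConj L) (IsCMField.complexConj_ne_one L) w hw).toField
  have hΦd : ((Matrix.of fun i j : Fin 2 => if i.val + j.val + 1 = 2 then (1 : L) else 0)).det ≠ 0 := (isUnit_antidiagOne_det (L := L) (N := 2)).ne_zero
  -- the torus is compact (elliptic frame of the regular `t₀`)
  obtain ⟨hd1', hframe₀⟩ := normOne_frame_of_mem_centralizer L v w hw t₀ P d ht₀ hP hd1 t₀ (Subgroup.mem_centralizer_singleton_iff.2 rfl)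
  have hd01 : ((P⁻¹).val * (t₀.1.val.val : Matrix (Fin 2) (Fin 2) (LocalRing L v)) * P.val) 0 0 ≠ ((P⁻¹).val * (t₀.1.val.val : Matrix (Fin 2) (Fin 2) (LocalRing L v)) * P.val) 1 1 := by
    have hsep : (finCharpolyTwo L v t₀).Separable := ht₀
    rw [finCharpolyTwo_eq_of_frame P hframe₀] at hsep
    exact ne_of_separable_X_sub_C_mul hsep
  haveI hZ₀ := compactSpace_centralizer_H_of_frame L v w hw t₀ P
    ![((P⁻¹).val * (t₀.1.val.val : Matrix (Fin 2) (Fin 2) (LocalRing L v)) * P.val) 0 0, ((P⁻¹).val * (t₀.1.val.val : Matrix (Fin 2) (Fin 2) (LocalRing L v)) * P.val) 1 1] hframe₀ (injective_vecCons_two hd01) hd1'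
  obtain ⟨fC, hfC, hcoreF⟩ := hcore
  refine ⟨fC, hfC, (isClosed_tsupport fC).isCompact, fun t hRt => ?_⟩
  -- the frame of `t`, its regularity, its compact centraliser
  have hregt : IsRegularElt ((t : ((cmDatum L 2 (Matrix.of fun i j : Fin 2 => if i.val + j.val + 1 = 2 then (1 : L) else 0)).Local v × (cmDatum L 1 (Matrix.of fun i j : Fin 1 => if i.val + j.val + 1 = 1 then (1 : L) else 0)).Local v)).1.val : GL (Fin 2) (LocalRing L v)) := hReg _ hRt
  obtain ⟨hτ1, hframe⟩ := normOne_frame_of_mem_centralizer L v w hw t₀ P d ht₀ hP hd1 (t : ((cmDatum L 2 (Matrix.of fun i j : Fin 2 => if i.val + j.val + 1 = 2 then (1 : L) else 0)).Local v × (cmDatum L 1 (Matrix.of fun i j : Fin 1 => if i.val + j.val + 1 = 1 then (1 : L) else 0)).Local v)) t.2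
  have hτ01 : ((P⁻¹).val * ((t : ((cmDatum L 2 (Matrix.of fun i j : Fin 2 => if i.val + j.val + 1 = 2 then (1 : L) else 0)).Local v × (cmDatum L 1 (Matrix.of fun i j : Fin 1 => if i.val + j.val + 1 = 1 then (1 : L) else 0)).Local v)).1.val.val : Matrix (Fin 2) (Fin 2) (LocalRing L v)) * P.val) 0 0 ≠ ((P⁻¹).val * ((t : ((cmDatum L 2 (Matrix.of fun i j : Fin 2 => if i.val + j.val + 1 = 2 then (1 : L) else 0)).Local v × (cmDatum L 1 (Matrix.of fun i j : Fin 1 => if i.val + j.val + 1 = 1 then (1 : L) else 0)).Local v)).1.val.val : Matrix (Fin 2) (Fin 2) (LocalRing L v)) * P.val) 1 1 := by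
    have hsep : (finCharpolyTwo L v (t : ((cmDatum L 2 (Matrix.of fun i j : Fin 2 => if i.val + j.val + 1 = 2 then (1 : L) else 0)).Local v × (cmDatum L 1 (Matrix.of fun i j : Fin 1 => if i.val + j.val + 1 = 1 then (1 : L) else 0)).Local v))).Separable := hregt
    rw [finCharpolyTwo_eq_of_frame P hframe] at hsep
    exact ne_of_separable_X_sub_C_mul hsep
  have hτinj := injective_vecCons_two hτ01
  have hZt := compactSpace_centralizer_H_of_frame L v w hw (t : ((cmDatum L 2 (Matrix.of fun i j : Fin 2 => if i.val + j.val + 1 = 2 then (1 : L) else 0)).Local v × (cmDatum L 1 (Matrix.of fun i j : Fin 1 => if i.val + j.val + 1 = 1 then (1 : L) else 0)).Local v)) P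
    ![((P⁻¹).val * ((t : ((cmDatum L 2 (Matrix.of fun i j : Fin 2 => if i.val + j.val + 1 = 2 then (1 : L) else 0)).Local v × (cmDatum L 1 (Matrix.of fun i j : Fin 1 => if i.val + j.val + 1 = 1 then (1 : L) else 0)).Local v)).1.val.val : Matrix (Fin 2) (Fin 2) (LocalRing L v)) * P.val) 0 0, ((P⁻¹).val * ((t : ((cmDatum L 2 (Matrix.of fun i j : Fin 2 => if i.val + j.val + 1 = 2 then (1 : L) else 0)).Local v × (cmDatum L 1 (Matrix.of fun i j : Fin 1 => if i.val + j.val + 1 = 1 then (1 : L) else 0)).Local v)).1.val.val : Matrix (Fin 2) (Fin 2) (LocalRing L v)) * P.val) 1 1] hframe hτinj hτ1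
  -- the partner class: the stable class of `t` is `{⟦t⟧, d′}` (★ p842188); `t′ := out d′`
  obtain ⟨d', hd'ne, hset₀⟩ := exists_setOf_isLocalStablyConjH_out_eq_pair L w hw (h := (t : ((cmDatum L 2 (Matrix.of fun i j : Fin 2 => if i.val + j.val + 1 = 2 then (1 : L) else 0)).Local v × (cmDatum L 1 (Matrix.of fun i j : Fin 1 => if i.val + j.val + 1 = 1 then (1 : L) else 0)).Local v))) hframe hτinj hτ1
  -- re-read the set equality in this file's carrier spelling
  have hset : {d : ConjClasses ((cmDatum L 2 (Matrix.of fun i j : Fin 2 => if i.val + j.val + 1 = 2 then (1 : L) else 0)).Local v × (cmDatum L 1 (Matrix.of fun i j : Fin 1 => if i.val + j.val + 1 = 1 then (1 : L) else 0)).Local v) | IsLocalStablyConjH L v (t : ((cmDatum L 2 (Matrix.of fun i j : Fin 2 => if i.val + j.val + 1 = 2 then (1 : L) else 0)).Local v × (cmDatum L 1 (Matrix.of fun i j : Fin 1 => if i.val + j.val + 1 = 1 then (1 : L) else 0)).Local v)) (Quotient.out d)} = {ConjClasses.mk (t : ((cmDatum L 2 (Matrix.of fun i j : Fin 2 => if i.val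 + j.val + 1 = 2 then (1 : L) else 0)).Local v × (cmDatum L 1 (Matrix.of fun i j : Fin 1 => if i.val + j.val + 1 = 1 then (1 : L) else 0)).Local v)), d'} := hset₀
  have hout : ∀ c : ConjClasses ((cmDatum L 2 (Matrix.of fun i j : Fin 2 => if i.val + j.val + 1 = 2 then (1 : L) else 0)).Local v × (cmDatum L 1 (Matrix.of fun i j : Fin 1 => if i.val + j.val + 1 = 1 then (1 : L) else 0)).Local v), ConjClasses.mk (Quotient.out c) = c := fun c => by rw [← ConjClasses.quotient_mk_eq_mk, Quotient.out_eq]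
  have hst : IsLocalStablyConjH L v (t : ((cmDatum L 2 (Matrix.of fun i j : Fin 2 => if i.val + j.val + 1 = 2 then (1 : L) else 0)).Local v × (cmDatum L 1 (Matrix.of fun i j : Fin 1 => if i.val + j.val + 1 = 1 then (1 : L) else 0)).Local v)) (Quotient.out d') := by
    have h : d' ∈ {d : ConjClasses ((cmDatum L 2 (Matrix.of fun i j : Fin 2 => if i.val + j.val + 1 = 2 then (1 : L) else 0)).Local v × (cmDatum L 1 (Matrix.of fun i j : Fin 1 => if i.val + j.val + 1 = 1 then (1 : L) else 0)).Local v) | IsLocalStablyConjH L v (t : ((cmDatum L 2 (Matrix.of fun i j : Fin 2 => if i.val + j.val + 1 = 2 then (1 : L) else 0)).Local v × (cmDatum L 1 (Matrix.of fun i j : Fin 1 => if i.val + j.val + 1 = 1 then (1 : L) else 0)).Local v)) (Quotient.out d)} :=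
      (Set.ext_iff.1 hset d').2 (Set.mem_insert_of_mem _ (Set.mem_singleton d'))
    exact h
  have hnc : ¬ IsConj (t : ((cmDatum L 2 (Matrix.of fun i j : Fin 2 => if i.val + j.val + 1 = 2 then (1 : L) else 0)).Local v × (cmDatum L 1 (Matrix.of fun i j : Fin 1 => if i.val + j.val + 1 = 1 then (1 : L) else 0)).Local v)) (Quotient.out d') := fun h =>
    hd'ne ((hout d').symm.trans (ConjClasses.mk_eq_mk_iff_isConj.2 h).symm)
  have hRt' : Reg (Quotient.out d') := hstab _ _ hRt hst
  -- `Z(t′)` is compact too: `Z(t′.1) ≃ₜ* Z(t.1)` along the stable conjugacy, `Z(t′.2) ⊆ U(Φ₁)_v` compact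
  have hZt' : CompactSpace ↥(Subgroup.centralizer ({(Quotient.out d' : ((cmDatum L 2 (Matrix.of fun i j : Fin 2 => if i.val + j.val + 1 = 2 then (1 : L) else 0)).Local v × (cmDatum L 1 (Matrix.of fun i j : Fin 1 => if i.val + j.val + 1 = 1 then (1 : L) else 0)).Local v))} : Set ((cmDatum L 2 (Matrix.of fun i j : Fin 2 => if i.val + j.val + 1 = 2 then (1 : L) else 0)).Local v × (cmDatum L 1 (Matrix.of fun i j : Fin 1 => if i.val + j.val + 1 = 1 then (1 : L) else 0)).Local v))) := by
    have hΦh : (((Matrix.of fun i j : Fin 2 => if i.val + j.val + 1 = 2 then (1 : L) else 0)).map (cmConjRingHom L))ᵀ = (Matrix.of fun i j : Fin 2 => if i.val + j.val + 1 = 2 then (1 : L) else 0) := by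
      ext i j; fin_cases i <;> fin_cases j <;> simp [Matrix.of_apply]
    haveI : CompactSpace ↥(Subgroup.centralizer ({(t : ((cmDatum L 2 (Matrix.of fun i j : Fin 2 => if i.val + j.val + 1 = 2 then (1 : L) else 0)).Local v × (cmDatum L 1 (Matrix.of fun i j : Fin 1 => if i.val + j.val + 1 = 1 then (1 : L) else 0)).Local v)).1} : Set ((cmDatum L 2 (Matrix.of fun i j : Fin 2 => if i.val + j.val + 1 = 2 then (1 : L) else 0)).Local v))) :=
      compactSpace_centralizer_of_eigenframe_of_smul_eq L w hw _ hΦh hΦd (t : ((cmDatum L 2 (Matrix.of fun i j : Fin 2 => if i.val + j.val + 1 = 2 then (1 : L) else 0)).Local v × (cmDatum L 1 (Matrix.of fun i j : Fin 1 => if i.val + j.val + 1 = 1 then (1 : L) else 0)).Local v)).1 hframe hτinj hτ1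
    haveI hZ1 : CompactSpace ↥(Subgroup.centralizer ({(Quotient.out d' : ((cmDatum L 2 (Matrix.of fun i j : Fin 2 => if i.val + j.val + 1 = 2 then (1 : L) else 0)).Local v × (cmDatum L 1 (Matrix.of fun i j : Fin 1 => if i.val + j.val + 1 = 1 then (1 : L) else 0)).Local v)).1} : Set ((cmDatum L 2 (Matrix.of fun i j : Fin 2 => if i.val + j.val + 1 = 2 then (1 : L) else 0)).Local v))) :=
      (localStableCentralizerEquiv L v (N := 2) hΦd hΦd hst.1 hregt).toHomeomorph.compactSpace
    haveI : CompactSpace ((cmDatum L 1 (Matrix.of fun i j : Fin 1 => if i.val + j.val + 1 = 1 then (1 : L) else 0)).Local v) := compactSpace_cmDatum_local_one_of_smul_eq L _ w hw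
    have hZ1' : IsCompact ((Subgroup.centralizer ({(Quotient.out d' : ((cmDatum L 2 (Matrix.of fun i j : Fin 2 => if i.val + j.val + 1 = 2 then (1 : L) else 0)).Local v × (cmDatum L 1 (Matrix.of fun i j : Fin 1 => if i.val + j.val + 1 = 1 then (1 : L) else 0)).Local v)).1} : Set ((cmDatum L 2 (Matrix.of fun i j : Fin 2 => if i.val + j.val + 1 = 2 then (1 : L) else 0)).Local v)) : Subgroup ((cmDatum L 2 (Matrix.of fun i j : Fin 2 => if i.val + j.val + 1 = 2 then (1 : L) else 0)).Local v)) : Set ((cmDatum L 2 (Matrix.of fun i j : Fin 2 => if i.val + j.val + 1 = 2 then (1 : L) else 0)).Local v)) := isCompact_iff_compactSpace.2 hZ1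
    have hZ2 : IsCompact ((Subgroup.centralizer ({(Quotient.out d' : ((cmDatum L 2 (Matrix.of fun i j : Fin 2 => if i.val + j.val + 1 = 2 then (1 : L) else 0)).Local v × (cmDatum L 1 (Matrix.of fun i j : Fin 1 => if i.val + j.val + 1 = 1 then (1 : L) else 0)).Local v)).2} : Set ((cmDatum L 1 (Matrix.of fun i j : Fin 1 => if i.val + j.val + 1 = 1 then (1 : L) else 0)).Local v)) : Subgroup ((cmDatum L 1 (Matrix.of fun i j : Fin 1 => if i.val + j.val + 1 = 1 then (1 : L) else 0)).Local v)) : Set ((cmDatum L 1 (Matrix.of fun i j : Fin 1 => if i.val + j.val + 1 = 1 then (1 : L) else 0)).Local v)) :=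
      (isClosed_coe_centralizer_singleton (Quotient.out d' : ((cmDatum L 2 (Matrix.of fun i j : Fin 2 => if i.val + j.val + 1 = 2 then (1 : L) else 0)).Local v × (cmDatum L 1 (Matrix.of fun i j : Fin 1 => if i.val + j.val + 1 = 1 then (1 : L) else 0)).Local v)).2).isCompact
    refine isCompact_iff_compactSpace.1 ?_
    rw [show (Quotient.out d' : ((cmDatum L 2 (Matrix.of fun i j : Fin 2 => if i.val + j.val + 1 = 2 then (1 : L) else 0)).Local v × (cmDatum L 1 (Matrix.of fun i j : Fin 1 => if i.val + j.val + 1 = 1 then (1 : L) else 0)).Local v)) = ((Quotient.out d' : ((cmDatum L 2 (Matrix.of fun i j : Fin 2 => if i.val + j.val + 1 = 2 then (1 : L) else 0)).Local v × (cmDatum L 1 (Matrix.of fun i j : Fin 1 => if i.val + j.val + 1 = 1 then (1 : L) else 0)).Local v)).1, (Quotient.out d' : ((cmDatum L 2 (Matrix.of fun i j : Fin 2 => if i.val + j.val + 1 = 2 then (1 : L) else 0)).Local v × (cmDatum L 1 (Matrix.of fun i j : Fin 1 => if i.val + j.val + 1 = 1 then (1 : L) else 0)).Local v)).2) from rfl,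 coe_centralizer_prod_mk]
    exact hZ1'.prod hZ2
  -- canonical ⇒ Bochner at both classes
  have hΦt := classOrbitalIntegral_mk_eq_integral_conj_of_isCompact_centralizer L v ν hconj hm f hf.continuous (t : ((cmDatum L 2 (Matrix.of fun i j : Fin 2 => if i.val + j.val + 1 = 2 then (1 : L) else 0)).Local v × (cmDatum L 1 (Matrix.of fun i j : Fin 1 => if i.val + j.val + 1 = 1 then (1 : L) else 0)).Local v)) hRt hZt
  have hΦt' := classOrbitalIntegral_mk_eq_integral_conj_of_isCompact_centralizer L v ν hconj hm f hf.continuous (Quotient.out d') hRt' hZt'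
  rw [hout d'] at hΦt'
  -- assemble
  rw [finsum_mem_eq_add_of_eq_pair' hd'ne.symm hset, hΦt, hΦt', ← hcoreF t hregt (Quotient.out d') hst hnc]
  ring

/-- **(G4) THE CLOSER SHAPE — `RankOneUnstableTransferNonsplitCME` ⟸ (R1-core) at every INERT non-split place ∧ the RAMIFIED residue.**  `hcore` = the road's core theorem
((G1)–(G3), architect census 75cd9948 §2 with the norm-one amendment of T9-9 (2)) ∀-closed over the letter's data at the unramified non-split places; `hram` = the named
residue ★ `RankOneUnstableTransferNonsplitCMERamified` (def lane, F0P3-p02 (g12) ED. 4).  `by_cases` on `Algebra.IsUnramifiedIn (𝓞 L) v.asIdeal`; the inert branch is the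
pointwise engine. [cite: Rogawski1990, §4.9 Lemma 4.9.3 (4.9.2) p. 56] [cite: LabesseLanglands1979, §2] -/
theorem rankOneUnstableTransferNonsplitCME_of_core_of_ramified
    (hcore : ∀ (L : Type) [Field L] [NumberField L] [IsCMField L] (v : HeightOneSpectrum (𝓞 ↥(maximalRealSubfield L))),
      Subsingleton (PlacesOver L v) → Algebra.IsUnramifiedIn (𝓞 L) v.asIdeal →
      ∀ (μ : HeckeCharacter L) [MeasurableSpace ((cmDatum L 2 (Matrix.of fun i j : Fin 2 => if i.val + j.val + 1 = 2 then (1 : L) else 0)).Local v × (cmDatum L 1 (Matrix.of fun i j : Fin 1 => if i.val + j.val + 1 = 1 then (1 : L) else 0)).Local v)] [BorelSpace ((cmDatum L 2 (Matrix.of fun i j : Fin 2 => if i.val + j.val + 1 = 2 then (1 : L) else 0)).Local v × (cmDatum L 1 (Matrix.of fun i j : Fin 1 => if i.val + j.val + 1 = 1 then (1 : L) else 0)).Local v)] (ν : Measure ((cmDatum L 2 (Matrix.of fun i j : Fin 2 => if i.val + j.val + 1 = 2 then (1 : L) else 0)).Local v × (cmDatum L 1 (Matrix.of fun i j : Fin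 1 => if i.val + j.val + 1 = 1 then (1 : L) else 0)).Local v)) [ν.IsHaarMeasure] [ν.IsMulRightInvariant],
      μ.IsUnitary →
      (∀ x : ideleGroup ↥(maximalRealSubfield L), μ (AdeleRing.ideleBaseChange (↥(maximalRealSubfield L)) L x) = quadraticHeckeCharCM L x) →
      ∀ f : ((cmDatum L 2 (Matrix.of fun i j : Fin 2 => if i.val + j.val + 1 = 2 then (1 : L) else 0)).Local v × (cmDatum L 1 (Matrix.of fun i j : Fin 1 => if i.val + j.val + 1 = 1 then (1 : L) else 0)).Local v) → ℂ, IsLocSmooth f →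
      ∀ (t₀ : ((cmDatum L 2 (Matrix.of fun i j : Fin 2 => if i.val + j.val + 1 = 2 then (1 : L) else 0)).Local v × (cmDatum L 1 (Matrix.of fun i j : Fin 1 => if i.val + j.val + 1 = 1 then (1 : L) else 0)).Local v)) (P : GL (Fin 2) (LocalRing L v)) (d : Fin 2 → (LocalRing L v)),
        IsRegularElt (t₀.1.val : GL (Fin 2) (LocalRing L v)) →
        (t₀.1.val.val : Matrix (Fin 2) (Fin 2) (LocalRing L v)) * P.val = P.val * Matrix.diagonal d →
        (∀ i, conjLocal L (IsCMField.complexConj L) v (d i) * d i = 1) →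
      ∃ fC : ↥(Subgroup.centralizer ({t₀} : Set ((cmDatum L 2 (Matrix.of fun i j : Fin 2 => if i.val + j.val + 1 = 2 then (1 : L) else 0)).Local v × (cmDatum L 1 (Matrix.of fun i j : Fin 1 => if i.val + j.val + 1 = 1 then (1 : L) else 0)).Local v))) → ℂ, IsLocallyConstant fC ∧
        ∀ t : ↥(Subgroup.centralizer ({t₀} : Set ((cmDatum L 2 (Matrix.of fun i j : Fin 2 => if i.val + j.val + 1 = 2 then (1 : L) else 0)).Local v × (cmDatum L 1 (Matrix.of fun i j : Fin 1 => if i.val + j.val + 1 = 1 then (1 : L) else 0)).Local v))), IsRegularElt ((t : ((cmDatum L 2 (Matrix.of fun i j : Fin 2 => if i.val + j.val + 1 = 2 then (1 : L) else 0)).Local v × (cmDatum L 1 (Matrix.of fun i j : Fin 1 => if i.val + j.val + 1 = 1 then (1 : L) else 0)).Local v)).1.val : GL (Fin 2) (LocalRing L v)) → ∀ t' : ((cmDatum L 2 (Matrix.of fun i j : Fin 2 => if i.val + j.val + 1 = 2 then (1 : L) else 0)).Local v × (cmDatum L 1 (Matrix.of fun i j : Fin 1 => if i.val + j.val + 1 =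 1 then (1 : L) else 0)).Local v),
          IsLocalStablyConjH L v (t : ((cmDatum L 2 (Matrix.of fun i j : Fin 2 => if i.val + j.val + 1 = 2 then (1 : L) else 0)).Local v × (cmDatum L 1 (Matrix.of fun i j : Fin 1 => if i.val + j.val + 1 = 1 then (1 : L) else 0)).Local v)) t' → ¬ IsConj (t : ((cmDatum L 2 (Matrix.of fun i j : Fin 2 => if i.val + j.val + 1 = 2 then (1 : L) else 0)).Local v × (cmDatum L 1 (Matrix.of fun i j : Fin 1 => if i.val + j.val + 1 = 1 then (1 : L) else 0)).Local v)) t' →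
          ((finHeckeValue L v μ (((P⁻¹).val * ((t : ((cmDatum L 2 (Matrix.of fun i j : Fin 2 => if i.val + j.val + 1 = 2 then (1 : L) else 0)).Local v × (cmDatum L 1 (Matrix.of fun i j : Fin 1 => if i.val + j.val + 1 = 1 then (1 : L) else 0)).Local v)).1.val.val : Matrix (Fin 2) (Fin 2) (LocalRing L v)) * P.val) 0 0 - ((P⁻¹).val * ((t : ((cmDatum L 2 (Matrix.of fun i j : Fin 2 => if i.val + j.val + 1 = 2 then (1 : L) else 0)).Local v × (cmDatum L 1 (Matrix.of fun i j : Fin 1 => if i.val + j.val + 1 = 1 then (1 : L) else 0)).Local v)).1.val.val : Matrix (Fin 2) (Fin 2) (LocalRing L v)) * P.val) 1 1))⁻¹ : ℂ) *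
              ((Real.sqrt (∏ w' : PlacesOver L v, ‖(((P⁻¹).val * ((t : ((cmDatum L 2 (Matrix.of fun i j : Fin 2 => if i.val + j.val + 1 = 2 then (1 : L) else 0)).Local v × (cmDatum L 1 (Matrix.of fun i j : Fin 1 => if i.val + j.val + 1 = 1 then (1 : L) else 0)).Local v)).1.val.val : Matrix (Fin 2) (Fin 2) (LocalRing L v)) * P.val) 0 0 - ((P⁻¹).val * ((t : ((cmDatum L 2 (Matrix.of fun i j : Fin 2 => if i.val + j.val + 1 = 2 then (1 : L) else 0)).Local v × (cmDatum L 1 (Matrix.of fun i j : Fin 1 => if i.val + j.val + 1 = 1 then (1 : L) else 0)).Local v)).1.val.val : Matrix (Fin 2) (Fin 2) (LocalRing L v)) * P.val) 1 1) w'‖) : ℝ) : ℂ) * ((∫ y, f (y * (t : ((cmDatum L 2 (Matrix.of fun i j : Fin 2 => if i.val + j.val + 1 = 2 then (1 : L) else 0)).Local v × (cmDatum L 1 (Matrix.of fun i j : Fin 1 => if i.val + j.val + 1 = 1 then (1 : L) else 0)).Local v)) * y⁻¹) ∂ν) - ∫ y, f (y * t' * y⁻¹) ∂ν) = fC t)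
    (hram : RankOneUnstableTransferNonsplitCMERamified) : RankOneUnstableTransferNonsplitCME := by
  intro L _ _ _ v hv μ _ _ ν _ _ _iZ _bZ m hμu hμω Reg hReg hconj hstab hm f hf t₀ P d ht₀ hP hd1
  by_cases hunr : Algebra.IsUnramifiedIn (𝓞 L) v.asIdeal
  · exact rankOneUnstableTransfer_letter_at_of_core L v hv μ ν m Reg hReg hconj hstab hm f hf t₀ P d ht₀ hP hd1
      (hcore L v hv hunr μ ν hμu hμω f hf t₀ P d ht₀ hP hd1)
  · exact hram L v hv hunr μ ν m hμu hμω Reg hReg hconj hstab hm f hf t₀ P d ht₀ hP hd1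

end Engine

end Literature.NumberTheory.Rogawski1990

end
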